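import Summits.QuantumFields.BalabanUV.T4Continuum.Support.GradedWellUnitRowBound

/-!
# T⁴ programme, spine node NE2 (U1a), sub-row Δ1 — THE GRADED WELL, supplier brick «GW-V» file B5: THE THEOREM
# `n^d·Σ_{(z,μ)} |(Q_n A)(z,μ)|² ≤ ‖Q_GW A‖²` — the graded vector mass of the typed `RowV` (st-convention) DOMINATES the all-unit torus mass (`L ≥ 2`, layer map `≤ m`)

NE2 leaf prover 07, GEN 11 (`b2b-balaban-t4-ne2-formalise-leaf-07-g11`, numerics desk of sub-row Δ1), supplier brick «GW-V» for the row
owner's GRADED WELL (R47 journal 2026-08-21 l.25022; objects `GradedSubBlocks` p244783 / `GradedWellData` p244847; offer l.25494; numerics: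
memo `t4/T4-EST-NE2-D1-COLLAR.md` v1.1 §9.1b, job j114873 — `V = Q_GWᴴQ_GW − a·n^d·Q_⊤ᴴQ_⊤ ⪰ 0` to rounding for the typed `RowV`, FALSE for
the anchor-rule rows).

 * §11 `coef` (unit row ↦ `1` on itself, `½` on the layer-`≥ 1` rows in its direction anchored in its block or the next), `coef_nonneg`,
   `half_le_coef_of_mem_Tset`, `half_sum_Tset_le`, `anchor_eq_of_blockOf_eq`, **`sum_coef_le_one`** (THE DOUBLE COUNT: every typed row is
   charged `≤ 1` in total); §12 `asZero`, `omega0`, `sGW_zero`, `Xfull_omega0`, `omega0_mem_rowSet`, `coef_omega0`, **`unitRow_le`** (all cases),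
   **`unitMass_le_nsq_QvGW`** (THE THEOREM), `unitMass_le_form_localGW` (`a·n^d·Σ|Q_n A|² ≤ Re⟨A, localGW A⟩`, `0 ≤ a`).
 CONSUMERS: the mass part of R49 (a)'s `E_k = calDalev − regionGW` is ONE-SIGNED (`V ⪰ 0` ⇒ `‖V‖ ≤ ‖Q_GWᴴQ_GW‖`); the (GW-L) coercivity
 shortcut «localGW ≥ local(⊤)» (R47 (c), optional after R49); leaf-03-g9's (GW-L-co) socket.  The identification of `avgS (fine n M) n`
 with `B5Block118.QvOp n M` (row bijection `Anc n × Fin d ≃ Tor M × Fin d`) is NOT done here.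

HONEST FRAMING (T4-DAG p. 1).  [folklore] finite-torus combinatorics, Cauchy–Schwarz and bookkeeping on OUR model objects (U = 1, a
layer map on unit blocks, `m` fixed, finite torus); no estimate of Bałaban's is asserted, certified or disputed; NE2 (U1a) NOT proved; spine
PROVED 0/9 unchanged; NOT [B9] (3.16)/(3.23)–(3.27)/(3.42) as printed; NOT infinite volume / mass gap / Clay.  HONEST DEPENDENCY: continuum
YM on T⁴ ⇐ BetaPertH ∧ nine spine estimates (0/9 proved); BetaPertH ⇐ (D1) ∧ (D4) ∧ CAP+tail; G-an2-4 gates asym, D1 and NE2/3/4.  No `sorry`.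
-/

noncomputable section

open scoped BigOperators ComplexConjugate Matrix
open Finset

namespace Summit.QuantumFields.BalabanUV.T4Continuum.GradedWellUnitMass

open Literature.MathematicalPhysics.QuantumFieldTheory.Balaban1983to89.B5Prop11Plancherel (Tor fine unitVec)
open Literature.MathematicalPhysics.QuantumFieldTheory.Balaban1983to89.B5Prop11Lower (nsq nsq_nonneg)
open Literature.MathematicalPhysics.QuantumFieldTheory.Balaban1983to89.B5Block118 (tstep tstep_zero tstep_succ)
open Literature.MathematicalPhysics.QuantumFieldTheory.Balaban1983to89.B5Blocks16 (blockOf)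
open Literature.MathematicalPhysics.QuantumFieldTheory.Balaban1983to89.B5G183RateUnitTower (lev lev_neZero)
open Summit.QuantumFields.BalabanUV.T4Continuum
open Summit.QuantumFields.BalabanUV.T4Continuum.ScalarPlantingDefect (val_blockOf)
open Summit.QuantumFields.BalabanUV.T4Continuum.GradedSubBlocks (Anchor Anc InSub site meanS avgS avgS_mulVec s_pos site_add
  val_site anchor_add_tstep shiftAnc)
open Literature.MathematicalPhysics.QuantumFieldTheory.Balaban1983to89.B5Composition116 (tstep_add)
open Summit.QuantumFields.BalabanUV.T4Continuum.GradedContourRefine (subAnc subAnc_val mulOff mulOff_val norm_sq_avgS_le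
  anchor_of_dvd mul_lt_of_lt_div)
open Summit.QuantumFields.BalabanUV.T4Continuum.GradedWellData (sGW sGW_dvd wGW wGW_sq wGW_nonneg TorK RowV QvGW lev_eq_pow)
open Summit.QuantumFields.BalabanUV.T4Continuum.GradedWellSlice (sGW_dvd_lev sGW_dvd_sGW)

variable {d : ℕ}

section Main

variable (L : ℕ) [NeZero L] (M : Fin d → ℕ) [hM : ∀ μ, NeZero (M μ)] (k m : ℕ) (layer : Tor M → ℕ)

/-! ## §11 The charging coefficients and the double count -/

/-- the coefficient with which the unit contour `(z, μ)` charges the ambient row `ω`: `1` on its own unit row, `½` on the rows of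
layer `≥ 1` in direction `μ` anchored in the block of `z` or the next one, `0` otherwise. [folklore] -/
def coef (z : Anc (fine (lev L k) M) (lev L k)) (μ : Fin d) (ω : Amb L M k m) : ℝ :=
  if ω.2.2 = μ ∧ ω.2.1.1 = z.1 ∧ (ω.1 : ℕ) = 0 then 1
  else if ω.2.2 = μ ∧ 1 ≤ (ω.1 : ℕ) ∧
      (blockOf (lev L k) M ω.2.1.1 = blockOf (lev L k) M z.1 ∨
        blockOf (lev L k) M ω.2.1.1 = blockOf (lev L k) M z.1 + tstep M μ 1) then 1 / 2
  else 0

/-- `0 ≤ coef`. [folklore] -/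
theorem coef_nonneg (z : Anc (fine (lev L k) M) (lev L k)) (μ : Fin d) (ω : Amb L M k m) : 0 ≤ coef L M k m z μ ω := by
  unfold coef; split_ifs <;> norm_num

/-- on `Tset` the coefficient is `≥ ½`. [folklore] -/
theorem half_le_coef_of_mem_Tset (z : Anc (fine (lev L k) M) (lev L k)) (μ : Fin d) (ω : Amb L M k m)
    (h : ω ∈ Tset L M k m layer z μ) : 1 / 2 ≤ coef L M k m z μ ω := by
  rw [Tset, Finset.mem_filter] at h
  obtain ⟨_, hμ, h1, hb⟩ := h
  unfold coef
  split_ifs with hA hB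
  · norm_num
  · norm_num
  · exact absurd ⟨hμ, h1, hb⟩ hB

/-- `½·Σ_{Tset} X ≤ Σ_{rows} coef·X`. [folklore] -/
theorem half_sum_Tset_le (A : TorK L M k × Fin d → ℂ) (z : Anc (fine (lev L k) M) (lev L k)) (μ : Fin d) :
    (1 / 2) * ∑ ω ∈ Tset L M k m layer z μ, Xfull L M k m A ω
      ≤ ∑ ω ∈ rowSet L M k m layer, coef L M k m z μ ω * Xfull L M k m A ω := by
  calc (1 / 2) * ∑ ω ∈ Tset L M k m layer z μ, Xfull L M k m A ω
      = ∑ ω ∈ Tset L M k m layer z μ, (1 / 2) * Xfull L M k m A ω := Finset.mul_sum _ _ _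
    _ ≤ ∑ ω ∈ Tset L M k m layer z μ, coef L M k m z μ ω * Xfull L M k m A ω :=
        Finset.sum_le_sum fun ω hω => mul_le_mul_of_nonneg_right (half_le_coef_of_mem_Tset L M k m layer z μ ω hω) (Xfull_nonneg L M k m A ω)
    _ ≤ ∑ ω ∈ rowSet L M k m layer, coef L M k m z μ ω * Xfull L M k m A ω :=
        Finset.sum_le_sum_of_subset_of_nonneg (Finset.filter_subset _ _)
          fun ω _ _ => mul_nonneg (coef_nonneg L M k m z μ ω) (Xfull_nonneg L M k m A ω)

/-- unit anchors are determined by their block. [folklore] -/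
theorem anchor_eq_of_blockOf_eq {z z' : Anc (fine (lev L k) M) (lev L k)}
    (h : blockOf (lev L k) M z.1 = blockOf (lev L k) M z'.1) : z = z' := by
  apply Subtype.ext
  funext ν
  apply ZMod.val_injective
  have h1 := congrArg (fun B => (B ν).val) h
  simp only [val_blockOf] at h1
  obtain ⟨b, hb⟩ := z.2 ν
  obtain ⟨b', hb'⟩ := z'.2 ν
  rw [hb, hb', Nat.mul_div_cancel_left _ (lev_pos L k), Nat.mul_div_cancel_left _ (lev_pos L k)] at h1
  rw [hb, hb', h1]

/-- **THE DOUBLE COUNT**: every typed row is charged with total coefficient `≤ 1`. [folklore] -/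
theorem sum_coef_le_one (ω : Amb L M k m) :
    ∑ z : Anc (fine (lev L k) M) (lev L k), ∑ μ : Fin d, coef L M k m z μ ω ≤ 1 := by
  classical
  -- only μ = ω.2.2 contributes
  have hμ : ∀ z : Anc (fine (lev L k) M) (lev L k), ∑ μ : Fin d, coef L M k m z μ ω = coef L M k m z ω.2.2 ω := by
    intro z
    rw [Finset.sum_eq_single ω.2.2]
    · intro μ _ hne
      unfold coef
      rw [if_neg (fun h => hne h.1.symm), if_neg (fun h => hne h.1.symm)]
    · intro h; exact absurd (Finset.mem_univ _) h
  simp_rw [hμ]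
  by_cases h0 : (ω.1 : ℕ) = 0
  · -- layer-0 row: charged only by its own unit contour
    have hc : ∀ z : Anc (fine (lev L k) M) (lev L k),
        coef L M k m z ω.2.2 ω = if ω.2.1.1 = z.1 then 1 else 0 := by
      intro z
      unfold coef
      by_cases hz : ω.2.1.1 = z.1
      · rw [if_pos ⟨rfl, hz, h0⟩, if_pos hz]
      · rw [if_neg (fun h => hz h.2.1), if_neg (fun h => by omega), if_neg hz]
    simp_rw [hc]
    rw [Finset.sum_boole]
    have : (Finset.univ.filter (fun z : Anc (fine (lev L k) M) (lev L k) => ω.2.1.1 = z.1)).card ≤ 1 := by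
      apply Finset.card_le_one.mpr
      intro a ha b hb
      have ha' := (Finset.mem_filter.mp ha).2
      have hb' := (Finset.mem_filter.mp hb).2
      exact Subtype.ext (ha'.symm.trans hb')
    exact_mod_cast this
  · -- layer ≥ 1: charged ½ by at most two unit contours (block of the anchor, or the previous block)
    have h1 : 1 ≤ (ω.1 : ℕ) := Nat.one_le_iff_ne_zero.mpr h0
    have hc : ∀ z : Anc (fine (lev L k) M) (lev L k),
        coef L M k m z ω.2.2 ω ≤ (1 / 2) * ((if blockOf (lev L k) M z.1 = blockOf (lev L k) M ω.2.1.1 then 1 else 0)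
          + (if blockOf (lev L k) M z.1 + tstep M ω.2.2 1 = blockOf (lev L k) M ω.2.1.1 then 1 else 0)) := by
      intro z
      unfold coef
      rw [if_neg (fun h => h0 h.2.2)]
      by_cases hBc : (ω.2.2 = ω.2.2 ∧ 1 ≤ (ω.1 : ℕ) ∧
          (blockOf (lev L k) M ω.2.1.1 = blockOf (lev L k) M z.1 ∨
            blockOf (lev L k) M ω.2.1.1 = blockOf (lev L k) M z.1 + tstep M ω.2.2 1))
      · rw [if_pos hBc]
        rcases hBc.2.2 with h | h
        · rw [if_pos h.symm]; split_ifs <;> norm_num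
        · have h' : blockOf (lev L k) M z.1 + tstep M ω.2.2 1 = blockOf (lev L k) M ω.2.1.1 := h.symm
          simp only [h', if_true]; split_ifs <;> norm_num
      · rw [if_neg hBc]; split_ifs <;> norm_num
    calc ∑ z : Anc (fine (lev L k) M) (lev L k), coef L M k m z ω.2.2 ω
        ≤ ∑ z : Anc (fine (lev L k) M) (lev L k), (1 / 2) * ((if blockOf (lev L k) M z.1 = blockOf (lev L k) M ω.2.1.1 then 1 else 0)
          + (if blockOf (lev L k) M z.1 + tstep M ω.2.2 1 = blockOf (lev L k) M ω.2.1.1 then (1 : ℝ) else 0)) :=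
          Finset.sum_le_sum fun z _ => hc z
      _ = (1 / 2) * (((Finset.univ.filter (fun z : Anc (fine (lev L k) M) (lev L k) =>
              blockOf (lev L k) M z.1 = blockOf (lev L k) M ω.2.1.1)).card : ℝ)
            + ((Finset.univ.filter (fun z : Anc (fine (lev L k) M) (lev L k) =>
              blockOf (lev L k) M z.1 + tstep M ω.2.2 1 = blockOf (lev L k) M ω.2.1.1)).card : ℝ)) := by
          rw [← Finset.mul_sum, Finset.sum_add_distrib, Finset.sum_boole, Finset.sum_boole]
      _ ≤ (1 / 2) * (1 + 1) := by
          gcongr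
          · have : (Finset.univ.filter (fun z : Anc (fine (lev L k) M) (lev L k) =>
                blockOf (lev L k) M z.1 = blockOf (lev L k) M ω.2.1.1)).card ≤ 1 := by
              apply Finset.card_le_one.mpr
              intro a ha b hb
              exact anchor_eq_of_blockOf_eq L M k (((Finset.mem_filter.mp ha).2).trans ((Finset.mem_filter.mp hb).2).symm)
            exact_mod_cast this
          · have : (Finset.univ.filter (fun z : Anc (fine (lev L k) M) (lev L k) =>
                blockOf (lev L k) M z.1 + tstep M ω.2.2 1 = blockOf (lev L k) M ω.2.1.1)).card ≤ 1 := by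
              apply Finset.card_le_one.mpr
              intro a ha b hb
              have e := ((Finset.mem_filter.mp ha).2).trans ((Finset.mem_filter.mp hb).2).symm
              exact anchor_eq_of_blockOf_eq L M k (add_right_cancel e)
            exact_mod_cast this
      _ = 1 := by norm_num

/-! ## §12 The per-unit-row bound (all cases) and the theorem -/

/-- the unit anchor as a layer-`0` anchor (`s_0 = n`). [folklore] -/
def asZero (z : Anc (fine (lev L k) M) (lev L k)) : Anc (fine (lev L k) M) (sGW L k 0) :=
  ⟨z.1, fun ν => by show lev L (k - 0) ∣ _; rw [Nat.sub_zero]; exact z.2 ν⟩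

/-- the unit contour `(z, μ)` as a layer-`0` ambient row. [folklore] -/
def omega0 (z : Anc (fine (lev L k) M) (lev L k)) (μ : Fin d) : Amb L M k m := ⟨⟨0, Nat.succ_pos m⟩, (asZero L M k z, μ)⟩

omit [NeZero L] hM in
/-- `s_0 = n`. [folklore] -/
theorem sGW_zero : sGW L k 0 = lev L k := by
  show lev L (k - 0) = lev L k
  rw [Nat.sub_zero]

/-- `Xfull` of the unit row is `n^d·|(Q_n A)(z,μ)|²` (`w_0² = n^d`). [folklore] -/
theorem Xfull_omega0 (A : TorK L M k × Fin d → ℂ) (z : Anc (fine (lev L k) M) (lev L k)) (μ : Fin d) :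
    Xfull L M k m A (omega0 L M k m z μ) = ((lev L k : ℕ) : ℝ) ^ d * ‖(avgS (fine (lev L k) M) (lev L k) *ᵥ A) (z, μ)‖ ^ 2 := by
  show wGW L k d 0 ^ 2 * ‖(avgS (fine (lev L k) M) (sGW L k 0) *ᵥ A) (asZero L M k z, μ)‖ ^ 2 = _
  rw [wGW_sq]
  simp only [Nat.mul_zero, pow_zero, one_mul]
  have e' : ((sGW L k 0 : ℕ) : ℝ) = ((lev L k : ℕ) : ℝ) := by rw [sGW_zero]
  rw [e']
  rfl

/-- the unit row is a typed row when one endpoint block lies in layer `0`. [folklore] -/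
theorem omega0_mem_rowSet (z : Anc (fine (lev L k) M) (lev L k)) (μ : Fin d)
    (h0 : min (layer (blockOf (lev L k) M z.1)) (layer (blockOf (lev L k) M z.1 + tstep M μ 1)) = 0) :
    omega0 L M k m z μ ∈ rowSet L M k m layer := by
  rw [mem_rowSet]
  change min (layer (blockOf (lev L k) M z.1))
    (layer (blockOf (lev L k) M (z.1 + tstep (fine (lev L k) M) μ (sGW L k 0)))) = 0
  rw [sGW_zero, blockOf_unit_shift]
  exact h0

/-- the unit contour charges its own unit row with coefficient `1`. [folklore] -/
theorem coef_omega0 (z : Anc (fine (lev L k) M) (lev L k)) (μ : Fin d) : coef L M k m z μ (omega0 L M k m z μ) = 1 := by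
  unfold coef
  rw [if_pos ⟨rfl, rfl, rfl⟩]

/-- **EVERY UNIT CONTOUR IS DOMINATED BY THE ROWS IT CHARGES**: `n^d·|(Q_n A)(z,μ)|² ≤ Σ_{rows ω} coef(z,μ,ω)·w_ω²|(Q A)_ω|²`. [folklore] -/
theorem unitRow_le (hL : 2 ≤ L) (hlay : ∀ y, layer y ≤ m) (A : TorK L M k × Fin d → ℂ)
    (z : Anc (fine (lev L k) M) (lev L k)) (μ : Fin d) :
    ((lev L k : ℕ) : ℝ) ^ d * ‖(avgS (fine (lev L k) M) (lev L k) *ᵥ A) (z, μ)‖ ^ 2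
      ≤ ∑ ω ∈ rowSet L M k m layer, coef L M k m z μ ω * Xfull L M k m A ω := by
  classical
  by_cases h0 : min (layer (blockOf (lev L k) M z.1)) (layer (blockOf (lev L k) M z.1 + tstep M μ 1)) = 0
  · -- one endpoint block lies in layer 0: the unit contour is itself a typed row
    calc ((lev L k : ℕ) : ℝ) ^ d * ‖(avgS (fine (lev L k) M) (lev L k) *ᵥ A) (z, μ)‖ ^ 2
        = coef L M k m z μ (omega0 L M k m z μ) * Xfull L M k m A (omega0 L M k m z μ) := by
          rw [coef_omega0, one_mul, Xfull_omega0]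
      _ ≤ ∑ ω ∈ rowSet L M k m layer, coef L M k m z μ ω * Xfull L M k m A ω :=
          Finset.single_le_sum (f := fun ω => coef L M k m z μ ω * Xfull L M k m A ω)
            (fun ω _ => mul_nonneg (coef_nonneg L M k m z μ ω) (Xfull_nonneg L M k m A ω))
            (omega0_mem_rowSet L M k m layer z μ h0)
  · -- both endpoint blocks in layers ≥ 1: two-level Jensen
    set i := layer (blockOf (lev L k) M z.1) with hi
    set j := layer (blockOf (lev L k) M z.1 + tstep M μ 1) with hj
    have hlo1 : 1 ≤ min i j := Nat.one_le_iff_ne_zero.mpr h0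
    have hhi : max i j < m + 1 := Nat.lt_succ_of_le (max_le (hlay _) (hlay _))
    have hB : (i = min i j ∧ j = max i j) ∨ (i = max i j ∧ j = min i j) := by
      rcases le_total i j with h | h
      · exact Or.inl ⟨(min_eq_left h).symm, (max_eq_right h).symm⟩
      · exact Or.inr ⟨(max_eq_left h).symm, (min_eq_right h).symm⟩
    exact (unitRow_le_half_Tset L M k m layer hL A z μ (min i j) (max i j) hlo1 (min_le_max) hhi hB).trans
      (half_sum_Tset_le L M k m layer A z μ)

/-- **«GW-V»: THE GRADED VECTOR MASS DOMINATES THE ALL-UNIT TORUS MASS.**  For `L ≥ 2` and every layer map with values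
`≤ m`: `n^d·Σ_{unit anchors z, μ} |(Q_n A)(z,μ)|² ≤ ‖Q_GW A‖² = Σ_rows w_i²|(Q_{s_i}A)(z,μ)|²` — as forms,
`a·n^d·Q_⊤ᴴQ_⊤ ≤ a·Q_GWᴴQ_GW` for the typed `RowV` (st-convention).  Numerically exact (memo `T4-EST-NE2-D1-COLLAR` v1.1 §9.1b,
job j114873: min eig `−2e−15`; FAILS for the anchor-rule rows). [folklore] -/
theorem unitMass_le_nsq_QvGW (hL : 2 ≤ L) (hlay : ∀ y, layer y ≤ m) (A : TorK L M k × Fin d → ℂ) :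
    ((lev L k : ℕ) : ℝ) ^ d
        * ∑ z : Anc (fine (lev L k) M) (lev L k), ∑ μ : Fin d, ‖(avgS (fine (lev L k) M) (lev L k) *ᵥ A) (z, μ)‖ ^ 2
      ≤ nsq (QvGW L M k m layer *ᵥ A) := by
  classical
  rw [nsq_QvGW_eq, Finset.mul_sum]
  calc ∑ z : Anc (fine (lev L k) M) (lev L k), ((lev L k : ℕ) : ℝ) ^ d
          * ∑ μ : Fin d, ‖(avgS (fine (lev L k) M) (lev L k) *ᵥ A) (z, μ)‖ ^ 2
      = ∑ z : Anc (fine (lev L k) M) (lev L k), ∑ μ : Fin d,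
          ((lev L k : ℕ) : ℝ) ^ d * ‖(avgS (fine (lev L k) M) (lev L k) *ᵥ A) (z, μ)‖ ^ 2 := by
        simp_rw [Finset.mul_sum]
    _ ≤ ∑ z : Anc (fine (lev L k) M) (lev L k), ∑ μ : Fin d,
          ∑ ω ∈ rowSet L M k m layer, coef L M k m z μ ω * Xfull L M k m A ω :=
        Finset.sum_le_sum fun z _ => Finset.sum_le_sum fun μ _ => unitRow_le L M k m layer hL hlay A z μ
    _ = ∑ ω ∈ rowSet L M k m layer, (∑ z : Anc (fine (lev L k) M) (lev L k), ∑ μ : Fin d, coef L M k m z μ ω)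
          * Xfull L M k m A ω := by
        symm
        simp only [Finset.sum_mul]
        rw [Finset.sum_comm]
        refine Finset.sum_congr rfl fun z _ => ?_
        rw [Finset.sum_comm]
    _ ≤ ∑ ω ∈ rowSet L M k m layer, Xfull L M k m A ω :=
        Finset.sum_le_sum fun ω _ => by
          have h1 := sum_coef_le_one L M k m ω
          have hX := Xfull_nonneg L M k m A ω
          calc (∑ z : Anc (fine (lev L k) M) (lev L k), ∑ μ : Fin d, coef L M k m z μ ω) * Xfull L M k m A ω
              ≤ 1 * Xfull L M k m A ω := mul_le_mul_of_nonneg_right h1 hX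
            _ = Xfull L M k m A ω := one_mul _

/-- the same in the `form` currency of `GradedWellData`: `a·n^d·Σ|Q_n A|² ≤ Re⟨A, localGW A⟩` (`0 ≤ a`). [folklore] -/
theorem unitMass_le_form_localGW (hL : 2 ≤ L) (hlay : ∀ y, layer y ≤ m) {a : ℝ} (ha : 0 ≤ a)
    (A : TorK L M k × Fin d → ℂ) :
    a * (((lev L k : ℕ) : ℝ) ^ d
        * ∑ z : Anc (fine (lev L k) M) (lev L k), ∑ μ : Fin d, ‖(avgS (fine (lev L k) M) (lev L k) *ᵥ A) (z, μ)‖ ^ 2)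
      ≤ (star A ⬝ᵥ (GradedWellData.localGW L M k m layer a *ᵥ A)).re :=
  (mul_le_mul_of_nonneg_left (unitMass_le_nsq_QvGW L M k m layer hL hlay A) ha).trans
    (GradedWellData.mass_le_form_localGW L M k m layer a A)

end Main

end Summit.QuantumFields.BalabanUV.T4Continuum.GradedWellUnitMass

end
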